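import Summits.ABC.IUTFork.Cor312ThetaLocalLeContentHull
import Literature.IUT.LogVolume.TensorPacketFactorwiseOrbitSpan
import HarnessLib

/-!
# [IUTchIII] Corollary 3.12 — the Θ-side local term of ANY typed setting over a `p`-adic presentation is bounded BELOW
# by the per-summand content hulls `hull(p^{m(v⃗)}·log_p(R_{v⃗}^×))` (G1-Θ unit (U1)-HULL, reverse inequality)

PROOF-ONLY file (D-0012) of the abc-iut cell (R2 S-chain seat abc-iut-s2-p9, gen 0; branch C «abc ⇐ S», the «(or =)» half
of the mint's TARGET #2 'hΘ'). TAKES NO SIDE on [IUTchIII] Cor. 3.12. Companion of abc-iut-s2-p7's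
`Cor312ThetaLocalLeContentHull` (`thetaLocal_untopD_le_sum_content_hull`: `−|log(Θ)|_{j,v_ℚ} ≤ Σ_{v⃗} w(v⃗)·(−m(v⃗)·log p +
log μ̄_{v⃗}(hull(log_p(R_{v⃗}^×))))`, "with EQUALITY for the full (Ind2) group; here `≤`, the presented signature's (Ind2) being the
tensor families of lattice automorphisms"). THIS file proves the REVERSE inequality for the factorwise (Ind2) as typed
(c312-1 `LogShells.Ind2`: "independent copies of Ism on each of the direct summands of the `j+1` factors"), from the packet
algebra `Literature.IUT.LogVolume.smul_logPacket_subset_closure_factorwiseOrbit` (the `ℤ`-span of the FACTORWISE orbit of one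
vector of content exactly `p^m` is `p^m·log_p(R_I^×)` — no transitivity needed):

* `PadicPresentation.packetHull_subset_preimage_hullSet` — the summand components `ψ_{v⃗}⁻¹(λ·𝒪_L)` of a hull-set of the
  pulled-back real frame are `(R_I)^∼`-submodules, so they contain the hull of each subset;
* **`sum_content_hull_le_thetaLocal_untopD`** — for a setting `P` whose hull frame at `(j, v_ℚ)` is the pulled-back real frame
  of a presentation `Pr` (`hframe`) with the weighted summand log-measure (`hvol`) and `HullDefined` there: if every summand
  `v⃗` carries a vector of content EXACTLY `p^{m(v⃗)}` somewhere in the union of the possible images (`hwit`), and every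
  factorwise family of shell-preserving `ℚ_p`-linear automorphisms of the `K_{v⃗ a}` is realised on the summand `v⃗` by an
  element of the indeterminacy group (`hism` — true when Ism is ALL bicontinuous lattice automorphisms, Dupuy–Hilado §4.9),
  then `Σ_{v⃗} w(v⃗)·(−m(v⃗)·log p + log μ̄_{v⃗}(hull(log_p(R_{v⃗}^×)))) ≤ (−|log(Θ)|_{j,v_ℚ}).untopD 0`.

With abc-iut-s2-p7's upper bound at the same exponent family this pins the local Θ-volume to the orbit sum EXACTLY.
[cite: Mochizuki2012, IUTchIII Thm. 3.11 (i) (Ind2) p. 154] [cite: Mochizuki2012, IUTchIV Thm. 1.10 Step (v) p. 27–28]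
[cite: DupuyHilado2025, §4.9, §4.12] [claim: Mochizuki2012, status: disputed] for the quoted setting.
HONEST FRAMING: an inequality about the TYPED objects; nothing asserted or denied about Cor. 3.12; typed ≠ proved.
-/

noncomputable section

open Set Function
open scoped Pointwise

namespace Summit.ABC.IUTFork.Cor312Vol

open Thm311 Cor312 Literature.IUT.LogThetaLattice Literature.IUT.LogVolume

namespace PadicPresentation

variable {T : ThetaIndex} {L : LogShells T} {vQ : T.VQ} {p : ℕ} [hp : Fact p.Prime]
  (Pr : PadicPresentation L vQ p) {j : T.Label}

/-! ## §1. Summand components of hull-sets are `(R_I)^∼`-submodules -/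

/-- **`ψ_{v⃗}⁻¹(λ·𝒪_L)` contains the hull of each of its subsets**: the preimage of a polydisc under abc-iut-c312-3's decomposition
`ψ_{v⃗} : X_{v⃗} ≃ Π_i L_{v⃗,i}` is an additive subgroup (ultrametric) stable under multiplication by `(R_I)^∼` (`ψ((R_I)^∼)` is the
unit polydisc), hence an `(R_I)^∼`-submodule, and the hull is the `(R_I)^∼`-span ([IUTchIII] Rmk. 3.9.5 (i), (ii)).
[cite: Mochizuki2012, IUTchIII Rmk. 3.9.5 (ii) p. 127] -/
theorem packetHull_subset_preimage_hullSet (e : T.Caps j → T.Fibre vQ) (c : ∀ i : DIdx p (Pr.kk e), DFac p (Pr.kk e) i)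
    {M : Set (Pr.X e)} (hM : M ⊆ dEquiv p (Pr.kk e) ⁻¹' hullSet (DFac p (Pr.kk e)) c) :
    packetHull p (Pr.kk e) M ⊆ dEquiv p (Pr.kk e) ⁻¹' hullSet (DFac p (Pr.kk e)) c := by
  haveI : Nonempty (T.Caps j) := ⟨0⟩
  have hmem : ∀ y : Pr.X e, y ∈ dEquiv p (Pr.kk e) ⁻¹' hullSet (DFac p (Pr.kk e)) c ↔ ∀ i, ‖dEquiv p (Pr.kk e) y i‖ ≤ ‖c i‖ :=
    fun y => by rw [Set.mem_preimage, hullSet, mem_polydisc]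
  have hR : ∀ r : normalizedPacket p (Pr.kk e), ∀ i, ‖dEquiv p (Pr.kk e) (r : Pr.X e) i‖ ≤ 1 := by
    intro r i
    have h : dEquiv p (Pr.kk e) (r : Pr.X e) ∈ dEquiv p (Pr.kk e) '' (normalizedPacket p (Pr.kk e) : Set (Pr.X e)) :=
      Set.mem_image_of_mem _ r.2
    rw [image_normalizedPacket_eq_coe, coe_piUnitBallStructure, mem_polydisc] at h
    exact h i
  let W : Submodule (normalizedPacket p (Pr.kk e)) (Pr.X e) :=
    { carrier := dEquiv p (Pr.kk e) ⁻¹' hullSet (DFac p (Pr.kk e)) c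
      zero_mem' := by
        rw [hmem]
        intro i
        rw [map_zero, Pi.zero_apply, norm_zero]
        exact norm_nonneg _
      add_mem' := by
        intro a b ha hb
        rw [hmem] at ha hb ⊢
        intro i
        rw [map_add, Pi.add_apply]
        exact (IsUltrametricDist.norm_add_le_max _ _).trans (max_le (ha i) (hb i))
      smul_mem' := by
        intro r a ha
        rw [hmem] at ha ⊢
        intro i
        rw [Subring.smul_def, smul_eq_mul, map_mul, Pi.mul_apply, norm_mul]
        calc ‖dEquiv p (Pr.kk e) (r : Pr.X e) i‖ * ‖dEquiv p (Pr.kk e) a i‖ ≤ 1 * ‖c i‖ :=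
              mul_le_mul (hR r i) (ha i) (norm_nonneg _) zero_le_one
          _ = ‖c i‖ := one_mul _ }
  change ((packetSpan p (Pr.kk e) M : Submodule (normalizedPacket p (Pr.kk e)) (Pr.X e)) : Set (Pr.X e)) ⊆ (W : Set (Pr.X e))
  exact Submodule.span_le.mpr hM

end PadicPresentation

/-! ## §2. The reverse inequality: content hulls below the Θ-side local term -/

section Setting

open PadicPresentation

variable {T : ThetaIndex} {S : Situation T} {P : Cor312.Setting S} {vQ : T.VQ} {p : ℕ} [hp : Fact p.Prime]
  (Pr : PadicPresentation S.L vQ p)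

/-- **`Σ_{v⃗} w(v⃗)·(−m(v⃗)·log p + log μ̄_{v⃗}(hull(log_p(R_{v⃗}^×)))) ≤ (−|log(Θ)|_{j,v_ℚ}).untopD 0`.** Let the hull frame of the
setting `P` at `(j, v_ℚ)`, `j = i+1 ∈ 𝔽_l^⋇`, be the pulled-back real frame of the presentation `Pr` (`hframe`) with the weighted
summand log-measure on product regions (`hvol`), and let the union of the possible images admit its hull (`hdef`). Suppose
(`hwit`) every summand `v⃗` carries, somewhere in the union of the possible images, a vector of content EXACTLY `p^{m(v⃗)}`, and
(`hism`) every factorwise family `⊗_a g'_a` of `ℚ_p`-linear automorphisms of the `K_{v⃗ a}` preserving `log_p(𝒪^×)` is realised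
on the summand `v⃗` by a member of the indeterminacy group. Then the hull — a hull-set `e⁻¹(Π_{v⃗} ψ_{v⃗}⁻¹(λ_{v⃗}·𝒪))` — has
summand components containing the `ℤ`-span of the factorwise orbit of that vector, i.e. `p^{m(v⃗)}·log_p(R_{v⃗}^×)`
(`smul_logPacket_subset_closure_factorwiseOrbit`), hence `hull(p^{m(v⃗)}·log_p(R_{v⃗}^×))`, and the weighted log-measures
compare ([IUTchIV] Thm. 1.10 Step (v); Dupuy–Hilado §4.12, with print's factorwise (Ind2) in place of `Aut(I_{v⃗})`).
[cite: Mochizuki2012, IUTchIV Thm. 1.10 Step (v) p. 27–28] [cite: DupuyHilado2025, §4.9, §4.12] -/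
theorem sum_content_hull_le_thetaLocal_untopD (i : Fin T.lstar)
    [Fintype (Pr.factorIdx (Cor312.Setting.labelSucc i))] [Fintype (T.Caps (Cor312.Setting.labelSucc i) → T.Fibre vQ)]
    (hdef : P.HullDefined (Cor312.Setting.labelSucc i) vQ)
    (hframe : P.frame (Cor312.Setting.labelSucc i) vQ =
      HullFrame.ofComparison (Pr.factorField (Cor312.Setting.labelSucc i))
        (fun x => Pr.factorMap (Cor312.Setting.labelSucc i) x))
    (hvol : ∀ R : ∀ e : T.Caps (Cor312.Setting.labelSucc i) → T.Fibre vQ, Set (Pr.X e),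
      (∀ e, PacketAdm p (Pr.kk e) (R e)) →
        (S.D P.n).logvol (Cor312.Setting.labelSucc i) vQ
          (Pr.comparison (Cor312.Setting.labelSucc i) ⁻¹' Set.pi univ R) =
        ∑ e, Pr.w (Cor312.Setting.labelSucc i) e * packetLogμ p (Pr.kk e) (R e))
    (m : (T.Caps (Cor312.Setting.labelSucc i) → T.Fibre vQ) → ℤ)
    (hwit : ∀ e : T.Caps (Cor312.Setting.labelSucc i) → T.Fibre vQ, ∃ x ∈ ⋃₀ P.possibleImages (Cor312.Setting.labelSucc i) vQ,
      Pr.comparison (Cor312.Setting.labelSucc i) x e ∈ ((p : ℚ_[p]) ^ m e) • (logPacket p (Pr.kk e) : Set (Pr.X e)) ∧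
      Pr.comparison (Cor312.Setting.labelSucc i) x e ∉ ((p : ℚ_[p]) ^ (m e + 1)) • (logPacket p (Pr.kk e) : Set (Pr.X e)))
    (hism : ∀ (e : T.Caps (Cor312.Setting.labelSucc i) → T.Fibre vQ) (g' : ∀ a, Pr.kk e a ≃ₗ[ℚ_[p]] Pr.kk e a),
      (∀ a, g' a '' logUnits (Pr.kk e a) = logUnits (Pr.kk e a)) →
      ∃ Φ ∈ Cor312.Setting.indGroup S, ∀ x, Pr.comparison (Cor312.Setting.labelSucc i) (Φ (Cor312.Setting.labelSucc i) vQ x) e =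
        (PiTensorProduct.congr g' : Pr.X e ≃ₗ[ℚ_[p]] Pr.X e) (Pr.comparison (Cor312.Setting.labelSucc i) x e)) :
    ∑ e, Pr.w (Cor312.Setting.labelSucc i) e * (-(m e * Real.log p) +
        packetLogμ p (Pr.kk e) (packetHull p (Pr.kk e) (logPacket p (Pr.kk e) : Set (Pr.X e)))) ≤
      (P.thetaLocal (Cor312.Setting.labelSucc i) vQ).untopD 0 := by
  classical
  haveI : Nonempty (T.Caps (Cor312.Setting.labelSucc i)) := ⟨0⟩
  -- the local term is the log-volume of the hull
  have hloc : (P.thetaLocal (Cor312.Setting.labelSucc i) vQ).untopD 0 =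
      (S.D P.n).logvol (Cor312.Setting.labelSucc i) vQ (P.thetaHull (Cor312.Setting.labelSucc i) vQ) := by
    rw [Cor312.Setting.thetaLocal, if_pos hdef, WithTop.untopD_coe]
  -- the hull is a hull-set of the pulled-back real frame: `e⁻¹(Π_{v⃗} ψ_{v⃗}⁻¹(λ_{v⃗}·𝒪))`
  have hmem : P.thetaHull (Cor312.Setting.labelSucc i) vQ ∈ (P.frame (Cor312.Setting.labelSucc i) vQ).Hul :=
    (P.frame (Cor312.Setting.labelSucc i) vQ).hull_mem_of_hasHull hdef.1 hdef.2
  rw [hframe] at hmem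
  obtain ⟨H', hH', hH⟩ : ∃ H' ∈ (HullFrame.ofLocalFields (Pr.factorField (Cor312.Setting.labelSucc i))).Hul,
      P.thetaHull (Cor312.Setting.labelSucc i) vQ = (fun x => Pr.factorMap (Cor312.Setting.labelSucc i) x) ⁻¹' H' := hmem
  obtain ⟨c, hc, rfl⟩ := (HullFrame.mem_ofLocalFields_hul _).mp hH'
  rw [Pr.factorMap_preimage_hullSet] at hH
  have hWadm : ∀ e : T.Caps (Cor312.Setting.labelSucc i) → T.Fibre vQ, PacketAdm p (Pr.kk e)
      (dEquiv p (Pr.kk e) ⁻¹' hullSet (DFac p (Pr.kk e)) fun i' => c ⟨e, i'⟩) :=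
    fun e => Pr.packetAdm_preimage_hullSet e _ fun i' => hc ⟨e, i'⟩
  rw [hloc, hH, hvol _ hWadm]
  refine Finset.sum_le_sum fun e _ => mul_le_mul_of_nonneg_left ?_ (Pr.w_nonneg _ e)
  rw [← packetLogμ_packetHull_zpow_smul_logPacket p (Pr.kk e) (m e)]
  refine packetLogμ_mono p (Pr.kk e) (packetAdm_packetHull_zpow_smul_logPacket p (Pr.kk e) (m e)) (hWadm e) ?_
  -- the summand component `W_{v⃗}` of the hull contains the projection `M_{v⃗}` of the union of the possible images …
  have hUW : ∀ x ∈ ⋃₀ P.possibleImages (Cor312.Setting.labelSucc i) vQ,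
      Pr.comparison (Cor312.Setting.labelSucc i) x e ∈
        dEquiv p (Pr.kk e) ⁻¹' hullSet (DFac p (Pr.kk e)) fun i' => c ⟨e, i'⟩ := by
    intro x hx
    have hx' : x ∈ P.thetaHull (Cor312.Setting.labelSucc i) vQ := (P.frame (Cor312.Setting.labelSucc i) vQ).subset_hull _ hx
    rw [hH, Set.mem_preimage, Set.mem_univ_pi] at hx'
    exact hx' e
  -- … which is stable under every factorwise family of shell-preserving automorphisms (realised by the group) …
  have hstab : ∀ g' : ∀ a, Pr.kk e a ≃ₗ[ℚ_[p]] Pr.kk e a, (∀ a, g' a '' logUnits (Pr.kk e a) = logUnits (Pr.kk e a)) →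
      (PiTensorProduct.congr g' : Pr.X e ≃ₗ[ℚ_[p]] Pr.X e) ''
          ((fun x => Pr.comparison (Cor312.Setting.labelSucc i) x e) '' ⋃₀ P.possibleImages (Cor312.Setting.labelSucc i) vQ) ⊆
        (fun x => Pr.comparison (Cor312.Setting.labelSucc i) x e) '' ⋃₀ P.possibleImages (Cor312.Setting.labelSucc i) vQ := by
    intro g' hg'
    obtain ⟨Φ, hΦ, hΦe⟩ := hism e g' hg'
    rintro _ ⟨_, ⟨x, hx, rfl⟩, rfl⟩
    obtain ⟨V, ⟨Φ₀, hΦ₀, rfl⟩, ⟨y, hy, rfl⟩⟩ := Set.mem_sUnion.mp hx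
    refine ⟨Φ (Cor312.Setting.labelSucc i) vQ (Φ₀ (Cor312.Setting.labelSucc i) vQ y), ?_, hΦe _⟩
    exact Set.mem_sUnion.mpr ⟨(Φ * Φ₀) (Cor312.Setting.labelSucc i) vQ '' P.thetaRegion3 (Cor312.Setting.labelSucc i) vQ,
      ⟨Φ * Φ₀, (Cor312.Setting.indGroup S).mul_mem hΦ hΦ₀, rfl⟩, ⟨y, hy, rfl⟩⟩
  -- … and contains a vector of content exactly `p^{m(v⃗)}`: so it contains `p^{m(v⃗)}·log_p(R_{v⃗}^×)` …
  obtain ⟨x, hxU, hxm, hxm1⟩ := hwit e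
  have hA := smul_logPacket_subset_closure_factorwiseOrbit p (Pr.kk e)
    (M := (fun x => Pr.comparison (Cor312.Setting.labelSucc i) x e) '' ⋃₀ P.possibleImages (Cor312.Setting.labelSucc i) vQ)
    (Set.mem_image_of_mem _ hxU) hxm (zpow_content p (Pr.kk e) hxm hxm1).2
  have hMW : packetHull p (Pr.kk e)
      ((fun x => Pr.comparison (Cor312.Setting.labelSucc i) x e) '' ⋃₀ P.possibleImages (Cor312.Setting.labelSucc i) vQ) ⊆
        dEquiv p (Pr.kk e) ⁻¹' hullSet (DFac p (Pr.kk e)) fun i' => c ⟨e, i'⟩ :=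
    Pr.packetHull_subset_preimage_hullSet e _ (by rintro _ ⟨x, hx, rfl⟩; exact hUW x hx)
  have hΛW : ((p : ℚ_[p]) ^ m e) • (logPacket p (Pr.kk e) : Set (Pr.X e)) ⊆
      dEquiv p (Pr.kk e) ⁻¹' hullSet (DFac p (Pr.kk e)) fun i' => c ⟨e, i'⟩ := by
    refine hA.trans fun y hy => hMW ?_
    have hle : AddSubgroup.closure (⋃ g' ∈ {g' : ∀ a, Pr.kk e a ≃ₗ[ℚ_[p]] Pr.kk e a |
          ∀ a, g' a '' logUnits (Pr.kk e a) = logUnits (Pr.kk e a)},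
        (PiTensorProduct.congr g' : Pr.X e ≃ₗ[ℚ_[p]] Pr.X e) ''
          ((fun x => Pr.comparison (Cor312.Setting.labelSucc i) x e) '' ⋃₀ P.possibleImages (Cor312.Setting.labelSucc i) vQ)) ≤
        (packetSpan p (Pr.kk e) ((fun x => Pr.comparison (Cor312.Setting.labelSucc i) x e) ''
          ⋃₀ P.possibleImages (Cor312.Setting.labelSucc i) vQ)).toAddSubgroup := by
      rw [AddSubgroup.closure_le]
      exact (Set.iUnion₂_subset fun g' hg' => hstab g' hg').trans (subset_packetHull p (Pr.kk e) _)
    exact hle hy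
  -- … hence `hull(p^{m(v⃗)}·log_p(R_{v⃗}^×))`
  exact Pr.packetHull_subset_preimage_hullSet e _ hΛW

/-! ## §3. Dischargers for `hism` and `hwit` -/

/-- **`hism` from FULLNESS of Ism.** If every shell-preserving `ℚ_p`-linear automorphism of a `K_v` is (intertwined with) an
element of `Ism_v` (`hfull` — Dupuy–Hilado §4.9: Ism = ALL bicontinuous lattice automorphisms of `I_v`), then every factorwise
family `⊗_a g'_a` on the summand `v⃗` is realised there by a member of the indeterminacy group: pad `g'_a` by identities off the
summand `v⃗ a`, take the (Ind2) element `⊗_a ⊕_v g_{a,v}` at `(j, v_ℚ)` padded by identities at the other `(j', v_ℚ')`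
(c312-1 `Ind2Family` is a product), and read it through the comparison (c312-5 `comparison_factorwise`).
[cite: DupuyHilado2025, §4.9] [cite: Mochizuki2012, IUTchIII Thm. 3.11 (i) (Ind2) p. 154] -/
theorem exists_indGroup_comparison_eq_congr (j : T.Label)
    (hfull : ∀ (v : T.Fibre vQ) (g' : Pr.k v ≃ₗ[ℚ_[p]] Pr.k v), g' '' logUnits (Pr.k v) = logUnits (Pr.k v) →
      ∃ g ∈ S.L.ism v.1, ∀ x, Pr.φ v (g x) = g' (Pr.φ v x))
    (e : T.Caps j → T.Fibre vQ) (g' : ∀ a, Pr.kk e a ≃ₗ[ℚ_[p]] Pr.kk e a)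
    (hg' : ∀ a, g' a '' logUnits (Pr.kk e a) = logUnits (Pr.kk e a)) :
    ∃ Φ ∈ Cor312.Setting.indGroup S, ∀ x, Pr.comparison j (Φ j vQ x) e =
      (PiTensorProduct.congr g' : Pr.X e ≃ₗ[ℚ_[p]] Pr.X e) (Pr.comparison j x e) := by
  classical
  -- `g'_a` on the summand `v⃗ a` of the factor `a`, identities on the other summands
  let g'' : T.Caps j → ∀ v : T.Fibre vQ, Pr.k v ≃ₗ[ℚ_[p]] Pr.k v :=
    fun a => Function.update (fun v => LinearEquiv.refl ℚ_[p] (Pr.k v)) (e a) (g' a)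
  have hg''e : ∀ a, g'' a (e a) = g' a := fun a => by simp only [g'', Function.update_self]
  have hlog'' : ∀ a v, g'' a v '' logUnits (Pr.k v) = logUnits (Pr.k v) := by
    intro a v
    by_cases hv : v = e a
    · subst hv
      rw [hg''e]
      exact hg' a
    · have h : g'' a v = LinearEquiv.refl ℚ_[p] (Pr.k v) := Function.update_of_ne hv _ _
      rw [h]
      exact Set.image_id' _ ▸ Set.image_congr fun x _ => rfl
  choose g hgism hgφ using fun a v => hfull v (g'' a v) (hlog'' a v)
  -- the (Ind2) element at `(j, v_ℚ)`, padded by identities elsewhere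
  let Φ : S.L.PacketAut := Function.update (fun j' => fun vQ' => LinearEquiv.refl ℚ (S.L.Packet j' vQ')) j
    (Function.update (fun vQ' => LinearEquiv.refl ℚ (S.L.Packet j vQ')) vQ
      (S.L.factorwise j vQ fun a => S.L.summandwise vQ (g a)))
  have hΦj : Φ j vQ = S.L.factorwise j vQ (fun a => S.L.summandwise vQ (g a)) := by
    simp only [Φ, Function.update_self]
  have hΦ2 : Φ ∈ S.L.Ind2Family := by
    intro j' vQ'
    by_cases hj : j' = j
    · subst hj
      by_cases hv : vQ' = vQ
      · subst hv
        rw [hΦj]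
        exact ⟨g, hgism, rfl⟩
      · have h : Φ j' vQ' = LinearEquiv.refl ℚ _ := by
          simp only [Φ, Function.update_self, Function.update_of_ne hv]
        rw [h]
        exact S.L.refl_mem_Ind2 j' vQ'
    · have h : Φ j' vQ' = LinearEquiv.refl ℚ _ := by
        simp only [Φ, Function.update_of_ne hj]
      rw [h]
      exact S.L.refl_mem_Ind2 j' vQ'
  refine ⟨Φ, Subgroup.subset_closure (Set.mem_union_right _ hΦ2), fun x => ?_⟩
  rw [hΦj, Pr.comparison_factorwise g g'' hgφ x]
  simp only [hg''e]

/-- **`hwit` from PRODUCT BOXES.** If the (Ind3)-region contains the preimage `e⁻¹(Π_{v⃗} B_{v⃗})` of a product of boxes each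
containing `0`, then for every summand `v⃗`, permutation `σ` of the capsule and `z ∈ B_{v⃗∘σ}`, the vector `perm_σ(z) ∈ X_{v⃗}` is
the `v⃗`-component of a point of the union of the possible images: put `z` at `v⃗∘σ` and `0` elsewhere, pull back along the
(surjective) comparison, and apply the (Ind1)-family permuting the capsule at label `j` by `σ` (c312-5 `comparison_permute`).
[cite: DupuyHilado2025, §4.7] [cite: Mochizuki2012, IUTchIII Thm. 3.11 (i) (Ind1) p. 154] -/
theorem exists_mem_sUnion_possibleImages_comparison_eq_permX (j : T.Label)
    (B : ∀ e : T.Caps j → T.Fibre vQ, Set (Pr.X e)) (hB : Pr.comparison j ⁻¹' Set.pi univ B ⊆ P.thetaRegion3 j vQ)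
    (hB0 : ∀ e, (0 : Pr.X e) ∈ B e) (e : T.Caps j → T.Fibre vQ) (σ : Equiv.Perm (T.Caps j)) {z : Pr.X (e ∘ σ)}
    (hz : z ∈ B (e ∘ σ)) :
    ∃ x ∈ ⋃₀ P.possibleImages j vQ, Pr.comparison j x e = Pr.permX σ e z := by
  classical
  obtain ⟨x₀, hx₀⟩ := Pr.comparison_surjective j (Function.update (fun e' => (0 : Pr.X e')) (e ∘ σ) z)
  have hx₀R : x₀ ∈ P.thetaRegion3 j vQ := by
    refine hB ?_
    rw [Set.mem_preimage, hx₀, Set.mem_univ_pi]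
    intro e'
    by_cases h : e' = e ∘ σ
    · subst h
      rw [Function.update_self]
      exact hz
    · rw [Function.update_of_ne h]
      exact hB0 e'
  -- the (Ind1)-family permuting the capsule at label `j` by `σ` (identity strip parts; identity at other labels)
  let Φ : S.L.PacketAut := Function.update (fun j' => fun vQ' => LinearEquiv.refl ℚ (S.L.Packet j' vQ')) j
    (fun vQ' => S.L.permute j vQ' σ)
  have hΦj : ∀ vQ', Φ j vQ' = S.L.permute j vQ' σ := fun vQ' => by simp only [Φ, Function.update_self]
  have hΦ1 : Φ ∈ S.L.Ind1Family := by
    intro j'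
    by_cases hj : j' = j
    · subst hj
      refine ⟨σ, fun _ v => LinearEquiv.refl ℚ (S.L.carrier v), fun _ v => S.L.one_mem_stripAut v, fun vQ' => ?_⟩
      rw [S.L.summandwise_refl_family, S.L.factorwise_refl]
      show Φ j' vQ' = _
      rw [hΦj]
      rfl
    · have h : (fun vQ' => Φ j' vQ') = fun vQ' => LinearEquiv.refl ℚ _ := by
        funext vQ'
        simp only [Φ, Function.update_of_ne hj]
      show (fun vQ' => Φ j' vQ') ∈ S.L.Ind1 j'
      rw [h]
      exact S.L.refl_mem_Ind1 j'
  refine ⟨Φ j vQ x₀, Set.mem_sUnion.mpr ⟨Φ j vQ '' P.thetaRegion3 j vQ,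
    ⟨Φ, Subgroup.subset_closure (Set.mem_union_left _ hΦ1), rfl⟩, Set.mem_image_of_mem _ hx₀R⟩, ?_⟩
  rw [hΦj, Pr.comparison_permute, Pr.permΨ_apply, hx₀, Function.update_self]

end Setting

end Summit.ABC.IUTFork.Cor312Vol

end
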